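import Literature.Probability.RandomPlanarGeometry.WholePlaneSLEKappaRhoExistence
import Literature.Probability.RandomPlanarGeometry.WholePlaneSLEIncrementsGeneral
import Literature.Probability.RandomPlanarGeometry.WholePlaneRadialConcat
import Literature.Probability.RandomPlanarGeometry.StationaryAngleLawUniqueness
import HarnessLib

/-!
# Whole-plane SLE_κ(ρ) exists given a stationary angle law — every `κ ≠ 8`

Topic `Probability/RandomPlanarGeometry`; theorems only (no definition, no named fact). The
`κ ≤ 4`-free version of `WholePlaneSLEKappaRhoCurve` / `WholePlaneSLEKappaRhoExistence`:
Miller–Sheffield (2013), Prop. 2.5 for whole-plane SLE_κ(ρ) in the whole non-absorbing regime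
`κ ≤ 2(ρ + 2)` of `IsStationaryAngleLaw`, including the boundary-hitting values `κ > 4` where the
printed proof (via Lemma 2.4) does not apply. Probabilistic input: from every rational base time the
increment driver is a.s. locally generated by a curve in the closed disc up to its path horizon
(`IsStationaryAngleLaw.ae_locallyGenerated_angleIncrPath`, Rohde–Schramm for `κ ≠ 8` pulled back by
Schramm–Wilson). Deterministic input: the horizons cover unit windows uniformly
(`exists_pathHorizon_ge`), so concatenation gives generation over every horizon
(`locallyGenerated_of_windows`), and the chain is generated by its tip path
(`isCurve_tip_of_locallyGenerated`: the hulls are uniformly locally connected by Moore's theorem,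
`g_b⁻¹` extends continuously by Carathéodory).

* `IsStationaryAngleLaw.ae_isCurve_tip_of_ne_eight` — a.s. form on the angle path space;
* `isWholePlaneSLEKappaRho_prod_of_isStationaryAngleLaw_of_ne_eight`,
  `IsWholePlaneSLEKappaRho.exists_of_isStationaryAngleLaw_of_ne_eight` — the packaging on
  `C(ℝ, ℝ) × ℝ` with `wpCurve`;
* `IsWholePlaneSLEKappaRho.exists_of_ne_eight` — **the named fact `IsWholePlaneSLEKappaRho.exists`
  for every `κ ≠ 8`, granted the stationary angle law** (`IsStationaryAngleLaw.exists_unique`).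

What remains for the named fact: the existence of the stationary angle law (Miller–Sheffield (2013),
Prop. 2.1, the named fact `IsStationaryAngleLaw.exists_unique`) and the single value `κ = 8`
(chordal input: the named fact `hasSLETrace_eight`, Lawler–Schramm–Werner (2004), Thm. 4.4).

## References

* J. Miller, S. Sheffield, *Imaginary geometry IV*, PTRF 169 (2017), arXiv:1302.4738, Prop. 2.5,
  Prop. 2.1. [MillerSheffield2013]
* Ch. Pommerenke, *Boundary Behaviour of Conformal Maps*, Springer (1992), Thm. 2.1.
  [PommerenkeBBCM1992]
-/

noncomputable section

open MeasureTheory ProbabilityTheory Filter Topology Set Metric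
open scoped NNReal ENNReal Real

namespace Literature.Probability.RandomPlanarGeometry

open scoped PathBorel
open RadialSLE RadialLoewner

variable {κ : ℝ≥0} {ρ : ℝ} {P : Measure C(ℝ, ℝ)}

/-- **Whole-plane SLE_κ(ρ) is generated by a curve, every `κ ≠ 8` (a.s. form on the angle path
space).** Under a stationary SLE_κ(ρ) angle law with `0 < κ ≠ 8`, for `P`-a.e. angle path `X` and
every phase `q₀`, the driving angle `λ = drivingOfAngle q₀ X` is continuous, every whole-plane
Loewner chain driven by it is generated (`IsCurve`) by the tip path `WholePlaneLoewner.tip λ`, and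
the tip limits hold at every time. [cite: MillerSheffield2013, Prop. 2.5] -/
theorem IsStationaryAngleLaw.ae_isCurve_tip_of_ne_eight (hP : IsStationaryAngleLaw κ ρ P) (hκ : 0 < κ)
    (h8 : κ ≠ 8) :
    ∀ᵐ x ∂P, ∀ q₀ : ℝ, Continuous (drivingOfAngle q₀ x) ∧
      (∀ C : WholePlaneLoewnerChain (drivingOfAngle q₀ x), C.IsCurve (WholePlaneLoewner.tip (drivingOfAngle q₀ x))) ∧
      ∀ s : ℝ, Tendsto (fun R : ℝ ↦ WholePlaneLoewner.BackwardFlow.invMap (drivingOfAngle q₀ x) s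
          ((R : ℂ) * Complex.exp ((drivingOfAngle q₀ x s : ℝ) * Complex.I)))
        (𝓝[>] 1) (𝓝 (WholePlaneLoewner.tip (drivingOfAngle q₀ x) s)) := by
  have hε : (0 : ℝ) < 1 := one_pos
  have hε2 : (1 : ℝ) < π / 2 := by linarith [Real.pi_gt_three]
  have hnε : 2 * level 4 < (1 : ℝ) / 2 := by rw [level]; norm_num
  have hT : (0 : ℝ≥0) < 1 := one_pos
  have hall : ∀ᵐ x ∂P, ∀ b : ℚ, ∃ hc : Continuous (angleIncrPath x b),
      LocallyGenerated (angleIncrPath x b) (pathHorizon 4 1 1 ⟨angleIncrPath x b, hc⟩) :=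
    ae_all_iff.2 fun b ↦ hP.ae_locallyGenerated_angleIncrPath hκ h8 b hε hε2 hnε 1
  filter_upwards [hall, hP.2.1] with x hx hxI q₀
  have hlam : Continuous (drivingOfAngle q₀ x) := continuous_drivingOfAngle q₀ x hxI
  -- windows from rational bases, uniformly bounded below on unit windows
  have hwin : ∀ q : ℚ, LocallyGenerated (WholePlaneLoewnerChain.incr (drivingOfAngle q₀ x) q)
      (pathHorizon 4 1 1 (WholePlaneLoewnerChain.incrPath hlam q)) := by
    intro q
    obtain ⟨hc, hLG⟩ := hx q
    have he : WholePlaneLoewnerChain.incr (drivingOfAngle q₀ x) q = angleIncrPath x q :=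
      incr_drivingOfAngle hxI q₀ q
    have hpe : WholePlaneLoewnerChain.incrPath hlam q = ⟨angleIncrPath x q, hc⟩ := Subtype.ext he
    rw [hpe, he]
    exact hLG
  have hunif : ∀ t : ℝ, ∃ h₀ : ℝ≥0, 0 < h₀ ∧ ∀ q : ℚ, (q : ℝ) ∈ Icc (t - 1) t →
      h₀ ≤ pathHorizon 4 1 1 (WholePlaneLoewnerChain.incrPath hlam q) := by
    intro t
    obtain ⟨h₀, hh₀, -, hhor⟩ := WholePlaneLoewnerChain.exists_pathHorizon_ge hlam 4 hε2 hT t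
    exact ⟨h₀, hh₀, fun q hq ↦ hhor q hq⟩
  -- every horizon from every rational base
  have hloc : ∀ b ∈ Set.range (fun q : ℚ ↦ (q : ℝ)), ∀ u₁ : ℝ,
      LocallyGenerated (WholePlaneLoewnerChain.incr (drivingOfAngle q₀ x) b) u₁ := by
    rintro _ ⟨q, rfl⟩ u₁
    exact WholePlaneLoewnerChain.locallyGenerated_of_windows hlam
      (h := fun q ↦ pathHorizon 4 1 1 (WholePlaneLoewnerChain.incrPath hlam q)) hwin hunif q u₁
  have hB : ∀ T : ℝ, ∃ b ∈ Set.range (fun q : ℚ ↦ (q : ℝ)), b < T := fun T ↦ by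
    obtain ⟨q, hq⟩ := exists_rat_lt T
    exact ⟨q, ⟨q, rfl⟩, hq⟩
  refine ⟨hlam, fun C ↦ (C.isCurve_tip_of_locallyGenerated hlam hB hloc).1, ?_⟩
  obtain ⟨⟨C⟩, -⟩ := WholePlaneLoewnerChain.exists_unique_holds _ hlam
  exact (C.isCurve_tip_of_locallyGenerated hlam hB hloc).2

variable {P₀ : Measure C(ℝ, ℝ)}

/-- **Whole-plane SLE_κ(ρ) on the product space, given a stationary angle law (every `κ ≠ 8`).**
[cite: MillerSheffield2013, Prop. 2.5] -/
theorem isWholePlaneSLEKappaRho_prod_of_isStationaryAngleLaw_of_ne_eight (hP₀ : IsStationaryAngleLaw κ ρ P₀)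
    (hκ : 0 < κ) (h8 : κ ≠ 8) :
    IsWholePlaneSLEKappaRho κ ρ (P₀.prod uniformAngleLaw) wpCurve := by
  haveI := hP₀.isProbabilityMeasure
  refine ⟨measurable_wpCurve, Prod.fst, Prod.snd, measurable_fst, measurable_snd, ?_, ?_, ?_, ?_⟩
  · rw [Measure.map_fst_prod, measure_univ, one_smul]; exact hP₀
  · rw [Measure.map_snd_prod, measure_univ, one_smul]
  · exact indepFun_prod measurable_id measurable_id
  · set Good : Set C(ℝ, ℝ) := {x | (∀ t, x t ∈ Ioo 0 (2 * π)) ∧ ∀ q₀ : ℝ,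
      Continuous (drivingOfAngle q₀ x) ∧
      (∀ C : WholePlaneLoewnerChain (drivingOfAngle q₀ x), C.IsCurve (WholePlaneLoewner.tip (drivingOfAngle q₀ x))) ∧
      ∀ s : ℝ, Tendsto (fun R : ℝ ↦ WholePlaneLoewner.BackwardFlow.invMap (drivingOfAngle q₀ x) s
          ((R : ℂ) * Complex.exp ((drivingOfAngle q₀ x s : ℝ) * Complex.I)))
        (𝓝[>] 1) (𝓝 (WholePlaneLoewner.tip (drivingOfAngle q₀ x) s))} with hGood
    have hGoodae : ∀ᵐ x ∂P₀, x ∈ Good := by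
      filter_upwards [hP₀.2.1, hP₀.ae_isCurve_tip_of_ne_eight hκ h8] with x h1 h2
      exact ⟨h1, h2⟩
    have hnull : (P₀.prod uniformAngleLaw) {ω | ω.1 ∉ Good} = 0 := by
      have h1 : {ω : C(ℝ, ℝ) × ℝ | ω.1 ∉ Good} = Goodᶜ ×ˢ (univ : Set ℝ) := by
        ext ω; simp
      rw [h1, Measure.prod_prod]
      have h2 : P₀ Goodᶜ = 0 := by
        have := ae_iff.1 hGoodae
        rwa [show {a | a ∉ Good} = Goodᶜ from rfl] at this
      rw [h2, zero_mul]
    have hae : ∀ᵐ ω ∂P₀.prod uniformAngleLaw, ω.1 ∈ Good := by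
      rw [ae_iff]; simpa using hnull
    filter_upwards [hae] with ω hω
    obtain ⟨hI, hq⟩ := hω
    obtain ⟨hcont, hcurve, htend⟩ := hq ω.2
    obtain ⟨⟨C⟩, -⟩ := WholePlaneLoewnerChain.exists_unique_holds _ hcont
    refine ⟨C, ?_⟩
    have hgood : ω.1 ∈ goodAnglePaths := mem_goodAnglePaths_iff.2 hI
    have heq : wpCurve ω = WholePlaneLoewner.tip (drivingOfAngle ω.2 ω.1) := by
      funext t
      exact wpCurve_eq_tip hgood (htend t)
    rw [heq]
    exact hcurve C

/-- **`IsWholePlaneSLEKappaRho.exists` for every `0 < κ ≠ 8`, given a stationary SLE_κ(ρ) angle law.**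
[cite: MillerSheffield2013, Prop. 2.5] -/
theorem IsWholePlaneSLEKappaRho.exists_of_isStationaryAngleLaw_of_ne_eight (hP₀ : IsStationaryAngleLaw κ ρ P₀)
    (hκ : 0 < κ) (h8 : κ ≠ 8) :
    ∃ (Ω : Type) (_ : MeasurableSpace Ω) (P : Measure Ω) (γ : Ω → ℝ → ℂ),
      IsProbabilityMeasure P ∧ IsWholePlaneSLEKappaRho κ ρ P γ := by
  haveI := hP₀.isProbabilityMeasure
  exact ⟨C(ℝ, ℝ) × ℝ, inferInstance, P₀.prod uniformAngleLaw, wpCurve, inferInstance,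
    isWholePlaneSLEKappaRho_prod_of_isStationaryAngleLaw_of_ne_eight hP₀ hκ h8⟩

/-- **The named fact `IsWholePlaneSLEKappaRho.exists` for every `κ ≠ 8`, granted the stationary
angle law** (`IsStationaryAngleLaw.exists_unique`, Miller–Sheffield (2013), Prop. 2.1): for
`0 < κ`, `κ ≠ 8`, `κ ≤ 2(ρ + 2)` there is a probability space carrying a whole-plane SLE_κ(ρ)
curve from `0` to `∞`. [cite: MillerSheffield2013, Prop. 2.5 and Prop. 2.1] -/
theorem IsWholePlaneSLEKappaRho.exists_of_ne_eight (hlaw : IsStationaryAngleLaw.exists_unique)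
    (κ : ℝ≥0) (ρ : ℝ) (hκ : 0 < κ) (h8 : κ ≠ 8) (hκρ : (κ : ℝ) ≤ 2 * (ρ + 2)) :
    ∃ (Ω : Type) (_ : MeasurableSpace Ω) (P : Measure Ω) (γ : Ω → ℝ → ℂ),
      IsProbabilityMeasure P ∧ IsWholePlaneSLEKappaRho κ ρ P γ := by
  obtain ⟨P₀, hP₀, -⟩ := hlaw κ ρ hκ hκρ
  exact IsWholePlaneSLEKappaRho.exists_of_isStationaryAngleLaw_of_ne_eight hP₀ hκ h8

/-- **Whole-plane SLE_κ(ρ) from `0` to `∞` exists, for every `κ ≠ 8`** (unconditional): for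
`0 < κ`, `κ ≠ 8`, `κ ≤ 2(ρ + 2)` there is a probability space carrying a whole-plane SLE_κ(ρ) curve
(`IsWholePlaneSLEKappaRho`). This is the named fact `IsWholePlaneSLEKappaRho.exists`
(Miller–Sheffield (2013), Prop. 2.5) at every `κ ≠ 8`, now that the stationary angle law is
constructed and unique (`IsStationaryAngleLaw.exists_unique_holds`, Prop. 2.1). The single
remaining value `κ = 8` (`ρ ≥ 2`) needs chordal SLE₈ to be generated by a curve
(Lawler–Schramm–Werner (2004), Thm 4.7, the tree's named fact `hasSLETrace_eight`, for a general
Brownian motion), which is the chordal input of the pipeline at `κ = 8`.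
[cite: MillerSheffield2013, Prop. 2.5 and Prop. 2.1] -/
theorem IsWholePlaneSLEKappaRho.exists_ne_eight (κ : ℝ≥0) (ρ : ℝ) (hκ : 0 < κ) (h8 : κ ≠ 8)
    (hκρ : (κ : ℝ) ≤ 2 * (ρ + 2)) :
    ∃ (Ω : Type) (_ : MeasurableSpace Ω) (P : Measure Ω) (γ : Ω → ℝ → ℂ),
      IsProbabilityMeasure P ∧ IsWholePlaneSLEKappaRho κ ρ P γ :=
  IsWholePlaneSLEKappaRho.exists_of_ne_eight IsStationaryAngleLaw.exists_unique_holds κ ρ hκ h8 hκρ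

end Literature.Probability.RandomPlanarGeometry
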